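import Mathlib.Analysis.InnerProductSpace.Basic
import HarnessLib

/-!
# NE7LyapunovStencil1D — THE ONE-DIMENSIONAL LYAPUNOV INEQUALITY BEHIND THE COMPOSITE LETTER (C) OF THE EXACT WHITNEY LIFT, FLAT PROFILE, `L = 2`:
# `Σ_y [2‖v_y‖² + (3∕2)‖v_{y+e} − v_y‖²] ≤ 3·Σ_y [‖w_y‖² + (1∕4)‖w_{y+e} − w_y‖² + (5∕8)‖w_{y+2e} − 2w_{y+e} + w_y‖²]`, `w = (3∕4)v + (1∕4)v(·+e)`,
# on EVERY finite abelian group with EVERY step `e`, by an EXPLICIT rational sum-of-squares certificate (no Fourier analysis)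
# (lineage `b2b-balaban-t4-ne7b-p1`, gen 162; route (H′), memo `t4/b2b-balaban-t4-ne7b-p1/g162/records/SCOPING-LEVELMASSES.md` §10–§11, file (R3a))

Cell `pub-balaban`, rung (B)+1 sub-cell t4, lineage `b2b-balaban-t4-ne7b-p1` (row NE7b OWNER + CRUX PROVER; junction service for row NE7 on ROAD-G116 §6 (G3)), generation 162.
WHY.  The budget ✓ `NE7LevelMassBudgetGrowth` closes (G3) once the composites of the exact one-step lift `r = W∘A⁻¹` (✓ `NE7WhitneyExactLiftFlat`) obey
`‖r_{i‥k−1}u‖² ≤ C·g^{k−i}·L^{(d−2)(k−i)}‖u‖²` with `g < L`.  By the tensor structure `W∘B_c⁻¹ = L⁻¹·⊗_μ(I_μ∘b_μ⁻¹)` this reduces to 1-D statements, one per profile (memo §10):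
the transverse tent factor is bounded, the longitudinal FLAT factor grows slowly (kit j345052: `4.0, 6.4, 8.7, 10.9, …` per `L^ℓ`).  Memo §11: the growth is controlled by a LYAPUNOV
QUADRATIC FORM `M = 1 + (1∕4)∇*∇ + (5∕8)Δ*Δ` (symbol `Φ = 1 + s∕4 + (5∕8)s²`, a supersolution of the 1-D frequency cascade with ratio `g_f = 3∕2 < 2`): the one-step monotonicity
`Q_fine(P b⁻¹ u) ≤ g_f·L·Q_coarse(u)` becomes, with `u = b v`, a LOCAL inequality between quadratic forms in `v` whose slack is a nonnegative trigonometric polynomial, hence (Fejér–Riesz) a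
sum of squares — here with an explicit RATIONAL certificate and a Cauchy–Schwarz remainder.  THIS FILE proves that local inequality on an arbitrary finite abelian group `G` with step `e`
(the torus `ℤ∕N` in direction μ), for fields with values in any real inner product space (the Hilbert–Schmidt currency; entrywise scalar).
WHAT ([folklore]; 0 def, 0 sorry):
§1 `sum_shift` (translation invariance of `Σ_y`), `norm_sq_comb4` (the square of a four-term combination), **`sum_norm_sq_comb4`** (H4): `Σ_y‖c₀v_y + c₁v_{y+e} + c₂v_{y+2e} + c₃v_{y+3e}‖² =
   (Σc_k²)R₀ + 2(c₀c₁+c₁c₂+c₂c₃)R₁ + 2(c₀c₂+c₁c₃)R₂ + 2c₀c₃R₃` with the autocorrelations `R_m = Σ_y⟨v_y, v_{y+me}⟩`; `abs_autocorr_le` (`|R_m| ≤ R₀`);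
§2 **`flat_lyapunov`** — the displayed inequality (`g_f·L = 3`): in autocorrelations `RHS − LHS = (7∕4)R₀ − (45∕64)R₁ − (3∕4)R₂ + (45∕64)R₃
   = Σ_y‖h̃₀v_y + h̃₁v_{y+e} + h̃₂v_{y+2e} + h̃₃v_{y+3e}‖² + e₀R₀ + e₁R₁ + e₂R₂ + e₃R₃`, `h̃ = (367∕1000, −2509∕10000, −367∕1000, 479∕500)`,
   `e = (49990719∕10⁸, 47∕10⁶, 8∕78125, −47∕10⁶)`, `e₀ ≥ |e₁| + |e₂| + |e₃|`.
§3 **`tent_lyapunov`** — the transverse (tent-profile) twin with ratio `g_t = 17∕16` (`g_t·L = 17∕8`): with the midpoint values `m_y = (v_y + v_{y+e})∕2` of the tent interpolant,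
   `Σ_y [‖v_y‖² + ‖m_y‖² + (1∕4)(‖m_y − v_y‖² + ‖v_{y+e} − m_y‖²) + (5∕8)‖m_y − 2v_{y+e} + m_{y+e}‖²] ≤ (17∕8)·Σ_y [‖w_y‖² + (1∕4)‖w_{y+e} − w_y‖² + (5∕8)‖w_{y+2e} − 2w_{y+e} + w_y‖²]`
   (left side = `M` of the tent refinement `Iv`: values, first and second fine differences); `RHS − LHS = (67∕32)R₀ − (831∕512)R₁ − (27∕32)R₂ + (255∕512)R₃`, certificate
   `h̃ = (1141∕5000, −103∕500, −1727∕2000, 5457∕5000)`, `e = (1249051∕2·10⁷, 2293∕4·10⁷, 41∕5·10⁶, −13617∕2·10⁸)`.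
So per level the Lyapunov form grows by at most `g_f·g_t^{d−1}·L^{d−2}` along the lift's main part: `(3∕2)(17∕16)³ = 1.80 < 2 = L` at `d = 4` (memo §11; the tensor assembly is file (R3c)).
WHAT IS NOT HERE: the identification of the left sides with `Q_fine(Pv)`, `Q_fine(Iv)` on the refined lattice, the tensor assembly, the gauge part (files (R3b–d)).
HONEST FRAMING (page 1): an elementary quadratic-form inequality for OUR lift's stencil; nothing of Bałaban's asserted; NOT (C), NOT (G3), NOT (G), NOT NE7∕NE3 as spine nodes; row NE7b NOT PRINTED ∕
NOT PROVED; spine 0∕9; finite T⁴ rung (B)+1 — NOT infinite volume, NOT mass gap, NOT BetaPertH, NOT Clay.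
-/

set_option autoImplicit false

open scoped BigOperators RealInnerProductSpace
open Finset

namespace Summit.QuantumFields.BalabanUV.T4Continuum.NE7LyapunovStencil1D

variable {G : Type*} [AddCommGroup G] [Fintype G]
variable {X : Type*} [NormedAddCommGroup X] [InnerProductSpace ℝ X]

/-! ## §1 Translation invariance, the four-term square, autocorrelations -/

omit [NormedAddCommGroup X] [InnerProductSpace ℝ X] in
/-- Translation invariance of the sum over a finite abelian group. [folklore] -/
theorem sum_shift {Y : Type*} [AddCommMonoid Y] (f : G → Y) (a : G) : ∑ y, f (y + a) = ∑ y, f y :=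
  Fintype.sum_equiv (Equiv.addRight a) (fun y => f (y + a)) f (fun _ => rfl)

omit [Fintype G] in
/-- The square of a four-term real combination in an inner product space. [folklore] -/
theorem norm_sq_comb4 (x0 x1 x2 x3 : X) (c0 c1 c2 c3 : ℝ) :
    ‖c0 • x0 + c1 • x1 + c2 • x2 + c3 • x3‖ ^ 2
      = c0 ^ 2 * ‖x0‖ ^ 2 + c1 ^ 2 * ‖x1‖ ^ 2 + c2 ^ 2 * ‖x2‖ ^ 2 + c3 ^ 2 * ‖x3‖ ^ 2
        + 2 * c0 * c1 * ⟪x0, x1⟫ + 2 * c0 * c2 * ⟪x0, x2⟫ + 2 * c0 * c3 * ⟪x0, x3⟫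
        + 2 * c1 * c2 * ⟪x1, x2⟫ + 2 * c1 * c3 * ⟪x1, x3⟫ + 2 * c2 * c3 * ⟪x2, x3⟫ := by
  rw [← real_inner_self_eq_norm_sq, ← real_inner_self_eq_norm_sq x0, ← real_inner_self_eq_norm_sq x1, ← real_inner_self_eq_norm_sq x2,
    ← real_inner_self_eq_norm_sq x3]
  simp only [inner_add_left, inner_add_right, real_inner_smul_left, real_inner_smul_right]
  rw [real_inner_comm x0 x1, real_inner_comm x0 x2, real_inner_comm x0 x3, real_inner_comm x1 x2, real_inner_comm x1 x3, real_inner_comm x2 x3]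
  ring

/-- **(H4) THE SUM OF SQUARES OF A FOUR-TERM STENCIL IN AUTOCORRELATIONS**: with `R_m = Σ_y⟨v_y, v_{y+me}⟩`,
`Σ_y‖c₀v_y + c₁v_{y+e} + c₂v_{y+2e} + c₃v_{y+3e}‖² = (Σc_k²)R₀ + 2(c₀c₁+c₁c₂+c₂c₃)R₁ + 2(c₀c₂+c₁c₃)R₂ + 2c₀c₃R₃`. [folklore] -/
theorem sum_norm_sq_comb4 (v : G → X) (e : G) (c0 c1 c2 c3 : ℝ) :
    ∑ y, ‖c0 • v y + c1 • v (y + e) + c2 • v (y + e + e) + c3 • v (y + e + e + e)‖ ^ 2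
      = (c0 ^ 2 + c1 ^ 2 + c2 ^ 2 + c3 ^ 2) * ∑ y, ‖v y‖ ^ 2
        + 2 * (c0 * c1 + c1 * c2 + c2 * c3) * ∑ y, ⟪v y, v (y + e)⟫
        + 2 * (c0 * c2 + c1 * c3) * ∑ y, ⟪v y, v (y + e + e)⟫
        + 2 * (c0 * c3) * ∑ y, ⟪v y, v (y + e + e + e)⟫ := by
  simp only [norm_sq_comb4, Finset.sum_add_distrib, ← Finset.mul_sum]
  -- the shifted sums
  have S1 : ∑ y, ‖v (y + e)‖ ^ 2 = ∑ y, ‖v y‖ ^ 2 := sum_shift (fun y => ‖v y‖ ^ 2) e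
  have S2 : ∑ y, ‖v (y + e + e)‖ ^ 2 = ∑ y, ‖v y‖ ^ 2 := by
    rw [sum_shift (fun y => ‖v (y + e)‖ ^ 2) e]; exact S1
  have S3 : ∑ y, ‖v (y + e + e + e)‖ ^ 2 = ∑ y, ‖v y‖ ^ 2 := by
    rw [sum_shift (fun y => ‖v (y + e + e)‖ ^ 2) e]; exact S2
  have S12 : ∑ y, ⟪v (y + e), v (y + e + e)⟫ = ∑ y, ⟪v y, v (y + e)⟫ := sum_shift (fun y => ⟪v y, v (y + e)⟫) e
  have S13 : ∑ y, ⟪v (y + e), v (y + e + e + e)⟫ = ∑ y, ⟪v y, v (y + e + e)⟫ := sum_shift (fun y => ⟪v y, v (y + e + e)⟫) e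
  have S23 : ∑ y, ⟪v (y + e + e), v (y + e + e + e)⟫ = ∑ y, ⟪v y, v (y + e)⟫ := by
    rw [sum_shift (fun y => ⟪v (y + e), v (y + e + e)⟫) e]; exact S12
  rw [S1, S2, S3, S12, S13, S23]
  ring

/-- `|R_m| ≤ R₀`: `|Σ_y⟨v_y, v_{y+a}⟩| ≤ Σ_y‖v_y‖²` (Cauchy–Schwarz, AM–GM, translation invariance). [folklore] -/
theorem abs_autocorr_le (v : G → X) (a : G) : |∑ y, ⟪v y, v (y + a)⟫| ≤ ∑ y, ‖v y‖ ^ 2 := by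
  refine (Finset.abs_sum_le_sum_abs _ _).trans ?_
  have h : ∀ y ∈ (Finset.univ : Finset G), |⟪v y, v (y + a)⟫| ≤ (‖v y‖ ^ 2 + ‖v (y + a)‖ ^ 2) / 2 := by
    intro y _
    have h1 := abs_real_inner_le_norm (v y) (v (y + a))
    nlinarith [sq_nonneg (‖v y‖ - ‖v (y + a)‖), norm_nonneg (v y), norm_nonneg (v (y + a))]
  refine (Finset.sum_le_sum h).trans (le_of_eq ?_)
  rw [← Finset.sum_div, Finset.sum_add_distrib, sum_shift (fun y => ‖v y‖ ^ 2) a]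
  ring

/-! ## §2 The flat Lyapunov inequality with its rational certificate -/

/-- **THE 1-D FLAT LYAPUNOV INEQUALITY (`L = 2`, ratio `g_f = 3∕2`)**: for every `v : G → X` and `w_y = (3∕4)v_y + (1∕4)v_{y+e}` (the one-direction stencil `b` of the Whitney lift),
`Σ_y [2‖v_y‖² + (3∕2)‖v_{y+e} − v_y‖²] ≤ 3·Σ_y [‖w_y‖² + (1∕4)‖w_{y+e} − w_y‖² + (5∕8)‖w_{y+2e} − 2w_{y+e} + w_y‖²]` — i.e. `P*M P ≤ g_f·L·b*M b` for the Lyapunov form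
`M = 1 + (1∕4)∇*∇ + (5∕8)Δ*Δ` (left side = `M` of the piecewise-constant refinement `Pv`, written on the coarse lattice).  Proof: every term is a four-term stencil square (H4); in
autocorrelations `RHS − LHS = (7∕4)R₀ − (45∕64)R₁ − (3∕4)R₂ + (45∕64)R₃ = Σ_y‖h̃·v‖² + Σ_m e_mR_m` with the rational certificate `h̃`, `e` of the header and `|R_m| ≤ R₀`. [folklore] -/
theorem flat_lyapunov (v w : G → X) (e : G) (hw : ∀ y, w y = (3 / 4 : ℝ) • v y + (1 / 4 : ℝ) • v (y + e)) :
    ∑ y, (2 * ‖v y‖ ^ 2 + (3 / 2 : ℝ) * ‖v (y + e) - v y‖ ^ 2)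
      ≤ 3 * ∑ y, (‖w y‖ ^ 2 + (1 / 4 : ℝ) * ‖w (y + e) - w y‖ ^ 2 + (5 / 8 : ℝ) * ‖w (y + e + e) - (2 : ℝ) • w (y + e) + w y‖ ^ 2) := by
  -- the autocorrelations
  set R0 : ℝ := ∑ y, ‖v y‖ ^ 2 with hR0def
  set R1 : ℝ := ∑ y, ⟪v y, v (y + e)⟫ with hR1def
  set R2 : ℝ := ∑ y, ⟪v y, v (y + e + e)⟫ with hR2def
  set R3 : ℝ := ∑ y, ⟪v y, v (y + e + e + e)⟫ with hR3def
  -- each term as a four-term stencil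
  have hgrad : ∀ y, v (y + e) - v y = (-1 : ℝ) • v y + (1 : ℝ) • v (y + e) + (0 : ℝ) • v (y + e + e) + (0 : ℝ) • v (y + e + e + e) := by
    intro y; simp only [neg_smul, one_smul, zero_smul, add_zero]; abel
  have hw0 : ∀ y, w y = (3 / 4 : ℝ) • v y + (1 / 4 : ℝ) • v (y + e) + (0 : ℝ) • v (y + e + e) + (0 : ℝ) • v (y + e + e + e) := by
    intro y; rw [hw]; simp only [zero_smul, add_zero]
  have hw1 : ∀ y, w (y + e) - w y = (-(3 / 4) : ℝ) • v y + (1 / 2 : ℝ) • v (y + e) + (1 / 4 : ℝ) • v (y + e + e) + (0 : ℝ) • v (y + e + e + e) := by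
    intro y; rw [hw, hw]; simp only [zero_smul, add_zero]; module
  have hw2 : ∀ y, w (y + e + e) - (2 : ℝ) • w (y + e) + w y
      = (3 / 4 : ℝ) • v y + (-(5 / 4) : ℝ) • v (y + e) + (1 / 4 : ℝ) • v (y + e + e) + (1 / 4 : ℝ) • v (y + e + e + e) := by
    intro y; rw [hw, hw, hw]; module
  have T2 : ∑ y, ‖v (y + e) - v y‖ ^ 2 = 2 * R0 - 2 * R1 := by
    rw [Finset.sum_congr rfl fun y _ => by rw [hgrad y], sum_norm_sq_comb4]; ring
  have T3 : ∑ y, ‖w y‖ ^ 2 = (5 / 8 : ℝ) * R0 + (3 / 8 : ℝ) * R1 := by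
    rw [Finset.sum_congr rfl fun y _ => by rw [hw0 y], sum_norm_sq_comb4]; ring
  have T4 : ∑ y, ‖w (y + e) - w y‖ ^ 2 = (7 / 8 : ℝ) * R0 + (-(1 / 2) : ℝ) * R1 + (-(3 / 8) : ℝ) * R2 := by
    rw [Finset.sum_congr rfl fun y _ => by rw [hw1 y], sum_norm_sq_comb4]; ring
  have T5 : ∑ y, ‖w (y + e + e) - (2 : ℝ) • w (y + e) + w y‖ ^ 2 = (9 / 4 : ℝ) * R0 + (-(19 / 8) : ℝ) * R1 + (-(1 / 4) : ℝ) * R2 + (3 / 8 : ℝ) * R3 := by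
    rw [Finset.sum_congr rfl fun y _ => by rw [hw2 y], sum_norm_sq_comb4]; ring
  -- the certificate square
  have SOS : 0 ≤ ∑ y, ‖(367 / 1000 : ℝ) • v y + (-(2509 / 10000) : ℝ) • v (y + e) + (-(367 / 1000) : ℝ) • v (y + e + e) + (479 / 500 : ℝ) • v (y + e + e + e)‖ ^ 2 :=
    Finset.sum_nonneg fun _ _ => by positivity
  rw [sum_norm_sq_comb4] at SOS
  -- Cauchy–Schwarz remainders
  have hR0 : 0 ≤ R0 := Finset.sum_nonneg fun _ _ => by positivity
  have hA1 := abs_autocorr_le v e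
  have hA2 := abs_autocorr_le v (e + e)
  have hA3 := abs_autocorr_le v (e + e + e)
  simp only [← add_assoc] at hA2 hA3
  have hA1' := (abs_le.mp hA1).1
  have hA2' := (abs_le.mp hA2).1
  have hA3' := (abs_le.mp hA3).2
  -- assemble
  rw [Finset.sum_add_distrib, Finset.sum_add_distrib, Finset.sum_add_distrib, ← Finset.mul_sum, ← Finset.mul_sum, ← Finset.mul_sum, ← Finset.mul_sum,
    T2, T3, T4, T5]
  rw [← hR0def, ← hR1def, ← hR2def, ← hR3def] at SOS
  rw [← hR0def]
  linarith [SOS, hA1', hA2', hA3', hR0]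

/-! ## §3 The tent Lyapunov inequality with its rational certificate -/

/-- **THE 1-D TENT LYAPUNOV INEQUALITY (`L = 2`, ratio `g_t = 17∕16`)**: for every `v : G → X`, the tent midpoints `m_y = (1∕2)v_y + (1∕2)v_{y+e}` and the stencil `w_y = (3∕4)v_y + (1∕4)v_{y+e}`,
`Σ_y [‖v_y‖² + ‖m_y‖² + (1∕4)(‖m_y − v_y‖² + ‖v_{y+e} − m_y‖²) + (5∕8)‖m_y − 2v_{y+e} + m_{y+e}‖²] ≤ (17∕8)·Σ_y [‖w_y‖² + (1∕4)‖w_{y+e} − w_y‖² + (5∕8)‖w_{y+2e} − 2w_{y+e} + w_y‖²]`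
— `I*M I ≤ g_t·L·b*M b` for the same Lyapunov form `M = 1 + (1∕4)∇*∇ + (5∕8)Δ*Δ`; `RHS − LHS = (67∕32)R₀ − (831∕512)R₁ − (27∕32)R₂ + (255∕512)R₃` with the rational certificate of
the header. [folklore] -/
theorem tent_lyapunov (v w m : G → X) (e : G) (hw : ∀ y, w y = (3 / 4 : ℝ) • v y + (1 / 4 : ℝ) • v (y + e))
    (hm : ∀ y, m y = (1 / 2 : ℝ) • v y + (1 / 2 : ℝ) • v (y + e)) :
    ∑ y, (‖v y‖ ^ 2 + ‖m y‖ ^ 2 + (1 / 4 : ℝ) * (‖m y - v y‖ ^ 2 + ‖v (y + e) - m y‖ ^ 2) + (5 / 8 : ℝ) * ‖m y - (2 : ℝ) • v (y + e) + m (y + e)‖ ^ 2)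
      ≤ (17 / 8 : ℝ) * ∑ y, (‖w y‖ ^ 2 + (1 / 4 : ℝ) * ‖w (y + e) - w y‖ ^ 2 + (5 / 8 : ℝ) * ‖w (y + e + e) - (2 : ℝ) • w (y + e) + w y‖ ^ 2) := by
  set R0 : ℝ := ∑ y, ‖v y‖ ^ 2 with hR0def
  set R1 : ℝ := ∑ y, ⟪v y, v (y + e)⟫ with hR1def
  set R2 : ℝ := ∑ y, ⟪v y, v (y + e + e)⟫ with hR2def
  set R3 : ℝ := ∑ y, ⟪v y, v (y + e + e + e)⟫ with hR3def
  -- the stencils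
  have hw0 : ∀ y, w y = (3 / 4 : ℝ) • v y + (1 / 4 : ℝ) • v (y + e) + (0 : ℝ) • v (y + e + e) + (0 : ℝ) • v (y + e + e + e) := by
    intro y; rw [hw]; simp only [zero_smul, add_zero]
  have hw1 : ∀ y, w (y + e) - w y = (-(3 / 4) : ℝ) • v y + (1 / 2 : ℝ) • v (y + e) + (1 / 4 : ℝ) • v (y + e + e) + (0 : ℝ) • v (y + e + e + e) := by
    intro y; rw [hw, hw]; simp only [zero_smul, add_zero]; module
  have hw2 : ∀ y, w (y + e + e) - (2 : ℝ) • w (y + e) + w y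
      = (3 / 4 : ℝ) • v y + (-(5 / 4) : ℝ) • v (y + e) + (1 / 4 : ℝ) • v (y + e + e) + (1 / 4 : ℝ) • v (y + e + e + e) := by
    intro y; rw [hw, hw, hw]; module
  have hm0 : ∀ y, m y = (1 / 2 : ℝ) • v y + (1 / 2 : ℝ) • v (y + e) + (0 : ℝ) • v (y + e + e) + (0 : ℝ) • v (y + e + e + e) := by
    intro y; rw [hm]; simp only [zero_smul, add_zero]
  have hm1 : ∀ y, m y - v y = (-(1 / 2) : ℝ) • v y + (1 / 2 : ℝ) • v (y + e) + (0 : ℝ) • v (y + e + e) + (0 : ℝ) • v (y + e + e + e) := by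
    intro y; rw [hm]; simp only [zero_smul, add_zero]; module
  have hm2 : ∀ y, v (y + e) - m y = (-(1 / 2) : ℝ) • v y + (1 / 2 : ℝ) • v (y + e) + (0 : ℝ) • v (y + e + e) + (0 : ℝ) • v (y + e + e + e) := by
    intro y; rw [hm]; simp only [zero_smul, add_zero]; module
  have hm3 : ∀ y, m y - (2 : ℝ) • v (y + e) + m (y + e) = (1 / 2 : ℝ) • v y + (-1 : ℝ) • v (y + e) + (1 / 2 : ℝ) • v (y + e + e) + (0 : ℝ) • v (y + e + e + e) := by
    intro y; rw [hm, hm]; simp only [zero_smul, add_zero]; module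
  have T3 : ∑ y, ‖w y‖ ^ 2 = (5 / 8 : ℝ) * R0 + (3 / 8 : ℝ) * R1 := by
    rw [Finset.sum_congr rfl fun y _ => by rw [hw0 y], sum_norm_sq_comb4]; ring
  have T4 : ∑ y, ‖w (y + e) - w y‖ ^ 2 = (7 / 8 : ℝ) * R0 + (-(1 / 2) : ℝ) * R1 + (-(3 / 8) : ℝ) * R2 := by
    rw [Finset.sum_congr rfl fun y _ => by rw [hw1 y], sum_norm_sq_comb4]; ring
  have T5 : ∑ y, ‖w (y + e + e) - (2 : ℝ) • w (y + e) + w y‖ ^ 2 = (9 / 4 : ℝ) * R0 + (-(19 / 8) : ℝ) * R1 + (-(1 / 4) : ℝ) * R2 + (3 / 8 : ℝ) * R3 := by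
    rw [Finset.sum_congr rfl fun y _ => by rw [hw2 y], sum_norm_sq_comb4]; ring
  have U1 : ∑ y, ‖m y‖ ^ 2 = (1 / 2 : ℝ) * R0 + (1 / 2 : ℝ) * R1 := by
    rw [Finset.sum_congr rfl fun y _ => by rw [hm0 y], sum_norm_sq_comb4]; ring
  have U2 : ∑ y, ‖m y - v y‖ ^ 2 = (1 / 2 : ℝ) * R0 + (-(1 / 2) : ℝ) * R1 := by
    rw [Finset.sum_congr rfl fun y _ => by rw [hm1 y], sum_norm_sq_comb4]; ring
  have U3 : ∑ y, ‖v (y + e) - m y‖ ^ 2 = (1 / 2 : ℝ) * R0 + (-(1 / 2) : ℝ) * R1 := by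
    rw [Finset.sum_congr rfl fun y _ => by rw [hm2 y], sum_norm_sq_comb4]; ring
  have U4 : ∑ y, ‖m y - (2 : ℝ) • v (y + e) + m (y + e)‖ ^ 2 = (3 / 2 : ℝ) * R0 + (-2 : ℝ) * R1 + (1 / 2 : ℝ) * R2 := by
    rw [Finset.sum_congr rfl fun y _ => by rw [hm3 y], sum_norm_sq_comb4]; ring
  -- the certificate square
  have SOS : 0 ≤ ∑ y, ‖(1141 / 5000 : ℝ) • v y + (-(103 / 500) : ℝ) • v (y + e) + (-(1727 / 2000) : ℝ) • v (y + e + e) + (5457 / 5000 : ℝ) • v (y + e + e + e)‖ ^ 2 :=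
    Finset.sum_nonneg fun _ _ => by positivity
  rw [sum_norm_sq_comb4] at SOS
  have hR0 : 0 ≤ R0 := Finset.sum_nonneg fun _ _ => by positivity
  have hA1 := abs_autocorr_le v e
  have hA2 := abs_autocorr_le v (e + e)
  have hA3 := abs_autocorr_le v (e + e + e)
  simp only [← add_assoc] at hA2 hA3
  have hA1' := (abs_le.mp hA1).1
  have hA2' := (abs_le.mp hA2).1
  have hA3' := (abs_le.mp hA3).2
  -- assemble
  have hL : ∑ y, (‖v y‖ ^ 2 + ‖m y‖ ^ 2 + (1 / 4 : ℝ) * (‖m y - v y‖ ^ 2 + ‖v (y + e) - m y‖ ^ 2) + (5 / 8 : ℝ) * ‖m y - (2 : ℝ) • v (y + e) + m (y + e)‖ ^ 2)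
      = R0 + ((1 / 2 : ℝ) * R0 + (1 / 2 : ℝ) * R1) + (1 / 4 : ℝ) * (((1 / 2 : ℝ) * R0 + (-(1 / 2) : ℝ) * R1) + ((1 / 2 : ℝ) * R0 + (-(1 / 2) : ℝ) * R1))
        + (5 / 8 : ℝ) * ((3 / 2 : ℝ) * R0 + (-2 : ℝ) * R1 + (1 / 2 : ℝ) * R2) := by
    rw [Finset.sum_add_distrib, Finset.sum_add_distrib, Finset.sum_add_distrib, ← Finset.mul_sum, ← Finset.mul_sum, Finset.sum_add_distrib, U1, U2, U3, U4]
  have hR : ∑ y, (‖w y‖ ^ 2 + (1 / 4 : ℝ) * ‖w (y + e) - w y‖ ^ 2 + (5 / 8 : ℝ) * ‖w (y + e + e) - (2 : ℝ) • w (y + e) + w y‖ ^ 2)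
      = ((5 / 8 : ℝ) * R0 + (3 / 8 : ℝ) * R1) + (1 / 4 : ℝ) * ((7 / 8 : ℝ) * R0 + (-(1 / 2) : ℝ) * R1 + (-(3 / 8) : ℝ) * R2)
        + (5 / 8 : ℝ) * ((9 / 4 : ℝ) * R0 + (-(19 / 8) : ℝ) * R1 + (-(1 / 4) : ℝ) * R2 + (3 / 8 : ℝ) * R3) := by
    rw [Finset.sum_add_distrib, Finset.sum_add_distrib, ← Finset.mul_sum, ← Finset.mul_sum, T3, T4, T5]
  rw [hL, hR]
  rw [← hR0def, ← hR1def, ← hR2def, ← hR3def] at SOS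
  linarith [SOS, hA1', hA2', hA3', hR0]

end Summit.QuantumFields.BalabanUV.T4Continuum.NE7LyapunovStencil1D
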